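import Summits.AtomisticToContinuum.HydrodynamicLimit.Theorems.CollisionIsometryCLTAdaptedWeightCLTBHContactToMassIdle
import Summits.AtomisticToContinuum.HydrodynamicLimit.Theorems.CollisionIsometryCLTAdaptedWeightCLTBHContactToMassDict

/-!
# Stub `stub_contactToMass` (S4) of the line `block-h-dissipation-closure`, helper file 5: H1 at the level of the
flow — the fraction of particles with no collision in a kinetic window vanishes
(crux `CollisionIsometryCLT.AdaptedWeightCLT`, stmt-AtomisticToContinuum-14868; `--supports`, anchor
`bhContactToMass_flowIdle_anchor`)

Composition of files 1 (`…BHContactToMassIdle`: H1 ⇒ the FOLD's idle fraction is small, by `9 · idleFrac ≤ iprF`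
and Markov) and 2 (`…BHContactToMassDict`: on the good set the FLOW-idle fraction of the window `(t − Δ, t]` is at
most the fold's, `flowIdleFrac ≤ idleFrac`): for every admissible window sequence `Δ_N → 0`,
`Δ_N (N+1)^{1/3} → ∞`, every window end `t > 0` and every level `ε > 0`,
`P_N{ε < flowIdleFrac (Φ N) (t − Δ_N) t} → 0` (`tendsto_measure_flowIdleFrac_gt`) and
`E_N[flowIdleFrac (Φ N) (t − Δ_N) t] → 0` (`tendsto_lintegral_flowIdleFrac`), the local Gibbs laws not charging
the complement of the good set (`ae_mem_good_localGibbsLaw`). This is the certified content of H1 that the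
charging argument of S4 consumes: along the non-equilibrium flow nobody is collision-starved on kinetic windows.
No definitions.
-/

namespace Summit.AtomisticToContinuum.HydrodynamicLimit.Theorems.BlockHDissipation

open scoped BigOperators Topology Classical MeasureTheory ENNReal InnerProductSpace
open Filter Set MeasureTheory
open Literature.Analysis.FluidPDE
open Summit.AtomisticToContinuum.HydrodynamicLimit.Theorems.ContactSourceDuhamel (T3 V3 Cfg Vel Flow Flows iprF)
open Summit.AtomisticToContinuum.HydrodynamicLimit.Theorems.ContactSourceDuhamel.TimeLocal
open Summit.AtomisticToContinuum.HydrodynamicLimit.Theorems.DiffuseBackwardInfluenceNeg (idleFrac)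
open Literature.MathematicalPhysics.KineticTheory (hsDiameter hsDiameter_le localGibbsLaw ae_mem_good_localGibbsLaw)

noncomputable section

namespace ContactToMass

variable {σ : ℝ}

/-- **H1 ⇒ `P{ε < flowIdleFrac} → 0`**: on every admissible window `(t − Δ_N, t]`, `t > 0`, the local-Gibbs
probability that more than a fraction `ε` of the particles see NO collision of the flow tends to `0`. -/
theorem tendsto_measure_flowIdleFrac_gt {a₀ θ₀ : T3 → ℝ} {u₀ : T3 → V3} (hσ : 0 < σ) (hσ2 : σ < 2⁻¹)
    {Φ : Flows σ} (hD : DiffuseAt σ a₀ θ₀ u₀ Φ) {Δ : ℕ → ℝ} (hΔ0 : ∀ N, 0 < Δ N) (hΔ : Tendsto Δ atTop (𝓝 0))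
    (hΔg : Tendsto (fun N : ℕ => Δ N * ((N + 1 : ℕ) : ℝ) ^ ((1 : ℝ) / 3)) atTop atTop) {t : ℝ} (ht : 0 < t)
    {ε : ℝ} (hε : 0 < ε) :
    Tendsto (fun N : ℕ => localGibbsLaw σ a₀ u₀ θ₀ N (Φ N)
      {z | ε < flowIdleFrac (Φ N) (t - Δ N) t z}) atTop (𝓝 0) := by
  have hG : ∀ N, (Torus.geometry (Fin 3)).IsHardSphereRegular (hsDiameter σ N) := fun N =>
    Torus.isHardSphereRegular_geometry ((hsDiameter_le hσ.le N).trans_lt hσ2)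
  have hgood : ∀ N, localGibbsLaw σ a₀ u₀ θ₀ N (Φ N) (Φ N).goodᶜ = 0 := fun N =>
    ae_iff.1 (ae_mem_good_localGibbsLaw σ a₀ u₀ θ₀ N (Φ N))
  refine tendsto_of_tendsto_of_tendsto_of_le_of_le tendsto_const_nhds
    (tendsto_measure_idleFrac_gt hσ hσ2 hD hΔ0 hΔ hΔg ht hε) (fun _ => zero_le) fun N => ?_
  exact measure_flowIdleFrac_gt_le (hG N) (Φ N) _ (hgood N) ε t (hΔ0 N).le

/-- **H1 ⇒ `E[flowIdleFrac] → 0`** on every admissible window `(t − Δ_N, t]`, `t > 0`. -/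
theorem tendsto_lintegral_flowIdleFrac {a₀ θ₀ : T3 → ℝ} {u₀ : T3 → V3} (hσ : 0 < σ) (hσ2 : σ < 2⁻¹)
    {Φ : Flows σ} (hD : DiffuseAt σ a₀ θ₀ u₀ Φ) {Δ : ℕ → ℝ} (hΔ0 : ∀ N, 0 < Δ N) (hΔ : Tendsto Δ atTop (𝓝 0))
    (hΔg : Tendsto (fun N : ℕ => Δ N * ((N + 1 : ℕ) : ℝ) ^ ((1 : ℝ) / 3)) atTop atTop) {t : ℝ} (ht : 0 < t) :
    Tendsto (fun N : ℕ => ∫⁻ z, ENNReal.ofReal (flowIdleFrac (Φ N) (t - Δ N) t z)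
      ∂(localGibbsLaw σ a₀ u₀ θ₀ N (Φ N))) atTop (𝓝 0) := by
  have hG : ∀ N, (Torus.geometry (Fin 3)).IsHardSphereRegular (hsDiameter σ N) := fun N =>
    Torus.isHardSphereRegular_geometry ((hsDiameter_le hσ.le N).trans_lt hσ2)
  have hgood : ∀ N, localGibbsLaw σ a₀ u₀ θ₀ N (Φ N) (Φ N).goodᶜ = 0 := fun N =>
    ae_iff.1 (ae_mem_good_localGibbsLaw σ a₀ u₀ θ₀ N (Φ N))
  refine tendsto_of_tendsto_of_tendsto_of_le_of_le tendsto_const_nhds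
    (tendsto_lintegral_idleFrac hD hΔ0 hΔ hΔg ht) (fun _ => zero_le) fun N => ?_
  exact lintegral_flowIdleFrac_le (hG N) (Φ N) _ (hgood N) t (hΔ0 N).le

/-- The same at a FIXED window end for windows ending inside the horizon: for `0 < t' ≤ t`... (bookkeeping form
used under the time integral `∫_{[0,t]} dt'`: the statement is per window end, dominated convergence in `t'` is
done in the charging file). -/
theorem tendsto_lintegral_flowIdleFrac_of_mem {a₀ θ₀ : T3 → ℝ} {u₀ : T3 → V3} (hσ : 0 < σ) (hσ2 : σ < 2⁻¹)
    {Φ : Flows σ} (hD : DiffuseAt σ a₀ θ₀ u₀ Φ) {Δ : ℕ → ℝ} (hΔ0 : ∀ N, 0 < Δ N) (hΔ : Tendsto Δ atTop (𝓝 0))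
    (hΔg : Tendsto (fun N : ℕ => Δ N * ((N + 1 : ℕ) : ℝ) ^ ((1 : ℝ) / 3)) atTop atTop) {t t' : ℝ}
    (ht' : t' ∈ Ioc 0 t) :
    Tendsto (fun N : ℕ => ∫⁻ z, ENNReal.ofReal (flowIdleFrac (Φ N) (t' - Δ N) t' z)
      ∂(localGibbsLaw σ a₀ u₀ θ₀ N (Φ N))) atTop (𝓝 0) :=
  tendsto_lintegral_flowIdleFrac hσ hσ2 hD hΔ0 hΔ hΔg ht'.1

end ContactToMass

/-- Registration anchor of this helper file (`--supports stmt-AtomisticToContinuum-14868`, stub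
`stub_contactToMass`, file 5): H1 (`DiffuseAt`) forces, at `0 < σ < 1/2`, the local-Gibbs probability that more
than a fraction `ε` of the particles see no collision OF THE FLOW in the window `(t − Δ_N, t]` to vanish, on
every admissible window sequence, at every `t > 0`, for every `ε > 0` — the `∀`-closed form of
`ContactToMass.tendsto_measure_flowIdleFrac_gt`. -/
theorem bhContactToMass_flowIdle_anchor : ∀ (σ : ℝ) (a₀ θ₀ : T3 → ℝ) (u₀ : T3 → V3), 0 < σ → σ < 2⁻¹ →
    ∀ Φ : Flows σ, DiffuseAt σ a₀ θ₀ u₀ Φ → ∀ Δ : ℕ → ℝ, (∀ N, 0 < Δ N) → Tendsto Δ atTop (𝓝 0) →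
      Tendsto (fun N : ℕ => Δ N * ((N + 1 : ℕ) : ℝ) ^ ((1 : ℝ) / 3)) atTop atTop → ∀ t : ℝ, 0 < t →
        ∀ ε : ℝ, 0 < ε → Tendsto (fun N : ℕ => localGibbsLaw σ a₀ u₀ θ₀ N (Φ N)
          {z | ε < ContactToMass.flowIdleFrac (Φ N) (t - Δ N) t z}) atTop (𝓝 0) :=
  fun _ _ _ _ hσ hσ2 _ hD _ hΔ0 hΔ hΔg _ ht _ hε =>
    ContactToMass.tendsto_measure_flowIdleFrac_gt hσ hσ2 hD hΔ0 hΔ hΔg ht hε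

end

end Summit.AtomisticToContinuum.HydrodynamicLimit.Theorems.BlockHDissipation
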